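import Summits.BirchSwinnertonDyer.BirchSwinnertonDyer.Theorems.ResidualThetaTransportAtTwoThetaLayerLambdaCongruenceAtTwoSocleOfCosocle
import Summits.BirchSwinnertonDyer.BirchSwinnertonDyer.Theorems.ResidualThetaTransportAtTwoThetaLayerLambdaCongruenceAtTwoCosocleKanPlus
import Literature.NumberTheory.EllipticCurves.ModularJacobianMultiplicityOneCosocleProofs
import HarnessLib

/-!
# Crux Kan⁺ `ThetaLayerLambdaCongruenceAtTwo` (stmt-BirchSwinnertonDyer-20688), line `birth`, skeleton v14 (ONE stub `hcosW`): the
# KERNEL-ROAD INTERFACE — SD₂ (the consumed, sign-free, `ℓ = 2`, left-kernel shape of the Hecke self-duality of `J₀(L)[2]`)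
# (i) feeds the stub: `hcosW ⟸ SD₂ ∧ Bz`, Kan⁺ ⟸ SD₂ ∧ Bz; (ii) is ASSEMBLED from a twisted-adjoint mod-`2` pairing on `Λ`

Cell `bsd-wall`, LEAD prover `bsd-wall-rtt-p3` g12 (`--supports stmt-BirchSwinnertonDyer-20688`; THEOREMS ONLY — no `def`, no named fact, no
`sorry`). BSD is not proved by this; every statement below is CONDITIONAL on its displayed hypotheses; nothing here closes an item.

WHY. Skeleton v14 (sha16 d44a8f0ea46080a7) has ONE stub, the curve-level cosocle statement `hcosW` («`dim_{𝕋/𝔪} Λ/𝔪Λ = 2` at the mod-`2`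
eigen-ideals of a good-supersingular-at-`2` curve, odd level»), supplied today by `cosocleW_of_aliasInputs h27800 h27798` (SD ∧ Bz, PUB²). The SD half
that every consumer destructures is only SD₂ := «for every odd `L`, a `𝕋`-balanced `ℤ/2`-pairing on `J₀(L)[2]` with trivial LEFT kernel» (w2 g8,
Lines/birth-sd2-architecture.md §0), which has a sign-free two-model Poincaré-duality architecture from the coset data `Γ₀(L)\SL₂(ℤ)` (bricks S1–S7;
S1 = the torsion Eichler–Shimura count, landed by w2 g8 / w4 g6). THIS FILE fixes the two ends of that road in the kernel:
* §1 `finrank_quotient_eq_two_of_sub_of_pairing` — COSOCLE from SOCLE with a LEFT-nondegenerate balanced pairing only (`|M[𝔪]| = |M/𝔪M|` both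
  ways from the left kernel, `natCard_torsionBySet_eq_natCard_quotient_of_pairing`, p650638; w3 g10's `…CosocleOfSelfDual` needs both kernels);
* §2 **`cosocleW_of_sdTwo_bz : SD₂ → Bz → hcosW`** and §3 **`thetaLayerLambdaCongruenceAtTwo_of_sdTwo_bz : SD₂ → Bz → Kan⁺`** — the kernel-road
  target under TODAY's typing of Buzzard: prove SD₂ (spelled inline, no named fact) and the crux is conditional on Bz ALONE;
* §4 **`sdTwo_of_twistedAdjointPairing`** — SD₂ at level `L` ASSEMBLED from what bricks S2–S6 deliver on `Λ = periodHomologyHecke L`: a biadditive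
  `Q : Λ × Λ → ℤ/2` (it kills `2Λ = {z + z}` on both sides automatically) with left kernel INSIDE `2Λ` (the mod-`2` intersection form through the
  Farey/dual models and the bridge), an additive `w : Λ → Λ` that is an involution mod `2Λ` (Fricke), `Q(T_p x, y) = Q(x, T_p y)` and
  `w T_p ≡ T_p w (mod 2Λ)` for `p ∤ L`, and `Q(U_q x, y) = Q(x, w U_q w y)` for `q ∣ L` (Merel: a correspondence and its transpose are adjoint;
  `U_qᵗ = w U_q w`). Then `B(x, y) := Q(x, w y)` is `𝕋`-balanced on generators (`twist_balanced_T`), hence on `𝕋 = ℤ[T_p]`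
  (`balanced_of_balanced_T`, `Algebra.adjoin_induction` along the injective `HeckeRing0.toEnd`), has left kernel inside `2Λ`, and descends to
  `J₀(L)[2]` along `x ↦ [x/2]` (`exists_pairing_of_surjective_ker_two` — abstract descent along a surjection with kernel `{z + z}` — instantiated
  by `J0.exists_linearDivMap` in `exists_pairing_torsionBy_two_of_pairing_periodHomology`) — literally the pair (hbal, hleft) the consumers destructure.
So the SD₂ programme's deliverable is EXACTLY the hypothesis list of §4, level by level; no orientation, sign or Riemann-surface input appears,
and «`2Λ`» is spelled `{z + z}` throughout (no second scalar action).

References: Darmon–Diamond–Taylor (1995) §1.3, §1.6 Lemma 1.38, §4.5 [DarmonDiamondTaylor1995]; L. Merel (1995) §1.2–2.3 [Merel1995Homologie];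
Buzzard, MRL 7 (2000) Prop. 2.4 [Buzzard2000LevelLoweringModTwo]; Pollack, Duke 118 (2003) Prop. 6.18 [Pollack2003].
-/

noncomputable section

-- justification: the `Summit.BirchSwinnertonDyer.BirchSwinnertonDyer.…` path repeats a component (route-file convention)
set_option linter.dupNamespace false
set_option autoImplicit false

open scoped MatrixGroups ModularForm NumberField
open CongruenceSubgroup Polynomial IsDedekindDomain Rat.HeightOneSpectrum
open Literature.NumberTheory.EllipticCurves Literature.NumberTheory.EllipticCurves.ModularForms
open Literature.NumberTheory.EllipticCurves.Rank1Residual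
open Summit.BirchSwinnertonDyer.BirchSwinnertonDyer.Theses.ResidualThetaTransportAtTwo

namespace Summit.BirchSwinnertonDyer.BirchSwinnertonDyer.Theorems.ThetaLayerLambdaCongruenceAtTwo

/-! ## §1 Cosocle from socle with a LEFT-nondegenerate balanced pairing -/

section CosocleOfSocle

variable {L : ℕ} [NeZero L]

/-- **QUOTIENT form from SUB form + a balanced pairing with trivial LEFT kernel.** For `𝔪 ∋ 2` maximal in `𝕋 = HeckeRing0 L 2` with
`|𝕋/𝔪| = 2`: if `dim_{𝕋/𝔪} J₀(L)[𝔪] = 2` and `J₀(L)[2]` carries a `𝕋`-balanced `ℤ/2`-pairing with trivial left kernel (SD₂ at `L`), then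
`dim_{𝕋/𝔪} Λ/𝔪Λ = 2` (`Λ = periodHomologyHecke L`): `|Λ/𝔪Λ| = |M/𝔪M| = |M[𝔪]| = |J₀(L)[𝔪]| = 4`. (The right kernel is never used.)
[cite: DarmonDiamondTaylor1995, §4.5 Thm. 4.26 (the two displays) and Lemma 1.38] -/
theorem finrank_quotient_eq_two_of_sub_of_pairing (𝔪 : Ideal (HeckeRing0 L 2)) [h𝔪 : 𝔪.IsMaximal]
    (h2 : (2 : HeckeRing0 L 2) ∈ 𝔪) (hq : Nat.card (HeckeRing0 L 2 ⧸ 𝔪) = 2)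
    (hsub : Module.finrank (HeckeRing0 L 2 ⧸ 𝔪) (Submodule.torsionBySet (HeckeRing0 L 2) (J0 L) 𝔪) = 2)
    (B : Submodule.torsionBy (HeckeRing0 L 2) (J0 L) ((2 : ℕ) : HeckeRing0 L 2) →+
      (Submodule.torsionBy (HeckeRing0 L 2) (J0 L) ((2 : ℕ) : HeckeRing0 L 2) →+ ZMod 2))
    (hbal : ∀ (t : HeckeRing0 L 2) x y, B (t • x) y = B x (t • y)) (hleft : ∀ x, (∀ y, B x y = 0) → x = 0) :
    Module.finrank (HeckeRing0 L 2 ⧸ 𝔪)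
      (periodHomologyHecke L ⧸ (𝔪 • ⊤ : Submodule (HeckeRing0 L 2) (periodHomologyHecke L))) = 2 := by
  classical
  haveI hMfin : Finite (Submodule.torsionBy (HeckeRing0 L 2) (J0 L) ((2 : ℕ) : HeckeRing0 L 2)) :=
    J0.finite_torsionBy L (ℓ := 2) two_ne_zero
  have h22 : ((2 : ℕ) : HeckeRing0 L 2) = 2 := Nat.cast_ofNat
  letI : Field (HeckeRing0 L 2 ⧸ 𝔪) := Ideal.Quotient.field 𝔪
  -- `|J₀(L)[𝔪]| = 4`
  haveI : Finite (Submodule.torsionBySet (HeckeRing0 L 2) (J0 L) 𝔪) :=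
    J0.finite_torsionBySet L two_ne_zero (by rw [← h22] at h2; exact h2)
  haveI : Module.Finite (HeckeRing0 L 2 ⧸ 𝔪) (Submodule.torsionBySet (HeckeRing0 L 2) (J0 L) 𝔪) := Module.Finite.of_finite
  have hcard4 : Nat.card (Submodule.torsionBySet (HeckeRing0 L 2) (J0 L) 𝔪) = 4 := by
    rw [Module.natCard_eq_pow_finrank (K := HeckeRing0 L 2 ⧸ 𝔪), hq, hsub]
    norm_num
  -- `M[𝔪] = J₀(L)[𝔪]`
  have htors_le : Submodule.torsionBySet (HeckeRing0 L 2) (J0 L) 𝔪 ≤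
      (Submodule.torsionBy (HeckeRing0 L 2) (J0 L) ((2 : ℕ) : HeckeRing0 L 2)) := by
    rw [h22]
    exact J0.torsionBySet_le_torsionBy L h2
  let e : {x : (Submodule.torsionBy (HeckeRing0 L 2) (J0 L) ((2 : ℕ) : HeckeRing0 L 2)) // ∀ t ∈ 𝔪, t • x = 0} ≃
      Submodule.torsionBySet (HeckeRing0 L 2) (J0 L) 𝔪 :=
    { toFun := fun x ↦ ⟨(x.1 : J0 L), (Submodule.mem_torsionBySet_iff _ _).mpr fun t ↦ by
        have h := congrArg Subtype.val (x.2 t t.2)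
        exact h⟩
      invFun := fun j ↦ ⟨⟨(j : J0 L), htors_le j.2⟩, fun t ht ↦ Subtype.ext
        ((Submodule.mem_torsionBySet_iff _ _).mp j.2 ⟨t, ht⟩)⟩
      left_inv := fun x ↦ rfl
      right_inv := fun j ↦ rfl }
  -- `|M[𝔪]| = |M/𝔪M|` (left kernel only) and `|Λ/𝔪Λ| = |M/𝔪M|`
  have h2M : ∀ x : (Submodule.torsionBy (HeckeRing0 L 2) (J0 L) ((2 : ℕ) : HeckeRing0 L 2)), (2 : ℕ) • x = 0 := fun x ↦ by
    have hx := x.2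
    rw [Submodule.mem_torsionBy_iff] at hx
    apply Subtype.ext
    rw [AddSubgroupClass.coe_nsmul, ZeroMemClass.coe_zero, ← Nat.cast_smul_eq_nsmul (HeckeRing0 L 2)]
    exact hx
  have hleft' : ∀ x : (Submodule.torsionBy (HeckeRing0 L 2) (J0 L) ((2 : ℕ) : HeckeRing0 L 2)), B x = 0 → x = 0 :=
    fun x hx ↦ hleft x fun y ↦ by rw [hx, AddMonoidHom.zero_apply]
  obtain ⟨hPfin, hcardPM⟩ := finite_and_natCard_quotient_periodHomologyHecke_eq (L := L) 𝔪 h2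
  haveI := hPfin
  haveI : Module.Finite (HeckeRing0 L 2 ⧸ 𝔪)
      (periodHomologyHecke L ⧸ (𝔪 • ⊤ : Submodule (HeckeRing0 L 2) (periodHomologyHecke L))) := Module.Finite.of_finite
  have hcardP : Nat.card (periodHomologyHecke L ⧸ (𝔪 • ⊤ : Submodule (HeckeRing0 L 2) (periodHomologyHecke L))) = 4 := by
    rw [hcardPM, ← natCard_torsionBySet_eq_natCard_quotient_of_pairing h2M B hbal hleft' 𝔪, Nat.card_congr e, hcard4]
  have hpow := Module.natCard_eq_pow_finrank (K := HeckeRing0 L 2 ⧸ 𝔪)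
    (V := periodHomologyHecke L ⧸ (𝔪 • ⊤ : Submodule (HeckeRing0 L 2) (periodHomologyHecke L)))
  rw [hcardP, hq] at hpow
  exact (Nat.pow_right_injective le_rfl (hpow.symm.trans (by norm_num : (4 : ℕ) = 2 ^ 2)))

end CosocleOfSocle

/-! ## §2 The v14 stub `hcosW` from SD₂ and Bz; §3 Kan⁺ from SD₂ and Bz -/

/-- **`hcosW ⟸ SD₂ ∧ Bz`** — the stub of skeleton v14 (`stub_cosocleMultOne`, verbatim conclusion) from Buzzard's mod-`2` multiplicity one AS
TYPED (sub form; its hypotheses discharged by `finrank_torsionBySet_eq_two_of_buzzard`, tp2-p1-w4 g0) and SD₂ = «for every odd `L`, a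
`𝕋`-balanced `ℤ/2`-pairing on `J₀(L)[2]` with trivial LEFT kernel» (spelled inline; the shape all consumers destructure from
`heckeSelfDual_torsionBy_J0`, and the target of the sign-free two-model architecture). [cite: Buzzard2000LevelLoweringModTwo, Prop. 2.4 and Def. 2.1–2.2 (p. 100–101)]
[cite: DarmonDiamondTaylor1995, §1.6 Lemma 1.38 and §4.5 Thm. 4.26] -/
theorem cosocleW_of_sdTwo_bz
    (hSD2 : ∀ (L : ℕ) [NeZero L], Odd L →
      ∃ B : Submodule.torsionBy (HeckeRing0 L 2) (J0 L) ((2 : ℕ) : HeckeRing0 L 2) →+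
          (Submodule.torsionBy (HeckeRing0 L 2) (J0 L) ((2 : ℕ) : HeckeRing0 L 2) →+ ZMod 2),
        (∀ (t : HeckeRing0 L 2) x y, B (t • x) y = B x (t • y)) ∧ (∀ x, (∀ y, B x y = 0) → x = 0))
    (hBz : buzzard2000_multiplicityOne_gamma0) :
    ∀ (W : WeierstrassCurve ℚ) [W.IsElliptic] [W.IsGloballyMinimal], GoodSS W 2 →
      ∀ (L : ℕ) [NeZero L], Odd L →
      (∀ v : HeightOneSpectrum (𝓞 ℚ), ¬ ((primesEquiv v : ℕ) ∣ 2 * L) → W.HasGoodReductionAt v) →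
      ∀ (𝔪 : Ideal (HeckeRing0 L 2)), 𝔪.IsMaximal → (2 : HeckeRing0 L 2) ∈ 𝔪 → Nat.card (HeckeRing0 L 2 ⧸ 𝔪) = 2 →
      (∀ (q : ℕ) (hq : q.Prime), ¬ q ∣ L → HeckeRing0.T L 2 q hq - (W.LFunction q : HeckeRing0 L 2) ∈ 𝔪) →
      Module.finrank (HeckeRing0 L 2 ⧸ 𝔪)
        (periodHomologyHecke L ⧸ (𝔪 • ⊤ : Submodule (HeckeRing0 L 2) (periodHomologyHecke L))) = 2 := by
  intro W _ _ hss L _ hL hgood 𝔪 h𝔪 h2 hq hT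
  haveI := h𝔪
  obtain ⟨B, hbal, hleft⟩ := hSD2 L hL
  exact finrank_quotient_eq_two_of_sub_of_pairing 𝔪 h2 hq
    (finrank_torsionBySet_eq_two_of_buzzard hBz W hss L hL hgood 𝔪 h𝔪 h2 hq hT) B hbal hleft

/-- **Kan⁺ `ThetaLayerLambdaCongruenceAtTwo` BY NAME from SD₂ ∧ Bz** (through skeleton v14's road `thetaLayerLambdaCongruenceAtTwo_of_cosocleW`,
w3 g10 p649433, and `cosocleW_of_sdTwo_bz`): the KERNEL-ROAD target under today's typing of Buzzard — discharge SD₂ (sign-free, `ℓ = 2`,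
left kernel; assembled by `sdTwo_of_twistedAdjointPairing` below from the two-model bricks) and the crux is conditional on Bz ALONE.
Conditional on SD₂ and Bz; BSD is not proved by this. [cite: Pollack2003, Conj. 6.3 and Prop. 6.18] [cite: Buzzard2000LevelLoweringModTwo, Prop. 2.4] -/
theorem thetaLayerLambdaCongruenceAtTwo_of_sdTwo_bz
    (hSD2 : ∀ (L : ℕ) [NeZero L], Odd L →
      ∃ B : Submodule.torsionBy (HeckeRing0 L 2) (J0 L) ((2 : ℕ) : HeckeRing0 L 2) →+
          (Submodule.torsionBy (HeckeRing0 L 2) (J0 L) ((2 : ℕ) : HeckeRing0 L 2) →+ ZMod 2),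
        (∀ (t : HeckeRing0 L 2) x y, B (t • x) y = B x (t • y)) ∧ (∀ x, (∀ y, B x y = 0) → x = 0))
    (hBz : buzzard2000_multiplicityOne_gamma0) : ThetaLayerLambdaCongruenceAtTwo :=
  thetaLayerLambdaCongruenceAtTwo_of_cosocleW (cosocleW_of_sdTwo_bz hSD2 hBz)

/-! ## §4 SD₂ at level `L` assembled from a twisted-adjoint mod-`2` pairing on `Λ` -/

section Assembly

variable {L : ℕ} [NeZero L]

set_option maxHeartbeats 400000 in
/-- Balancedness on the generators `T_p` propagates to all of `𝕋 = ℤ[T_p : p]` (the balanced elements form a subring;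
induction over `Algebra.adjoin`, transported along the injective ring map `HeckeRing0.toEnd`). [cite: DarmonDiamondTaylor1995, §4.1 (p. 107)] -/
theorem balanced_of_balanced_T {A : Type*} [AddCommGroup A]
    (B : periodHomologyHecke L →+ (periodHomologyHecke L →+ A))
    (hgen : ∀ (p : ℕ) (hp : p.Prime) (x y : periodHomologyHecke L),
      B (HeckeRing0.T L 2 p hp • x) y = B x (HeckeRing0.T L 2 p hp • y))
    (t : HeckeRing0 L 2) (x y : periodHomologyHecke L) : B (t • x) y = B x (t • y) := by
  have key : ∀ (u : Module.End ℂ (CuspForm (Gamma0 L) 2)), u ∈ heckeRing0 L 2 →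
      ∀ t : HeckeRing0 L 2, HeckeRing0.toEnd L 2 t = u → ∀ x y : periodHomologyHecke L, B (t • x) y = B x (t • y) := by
    intro u hu
    change u ∈ Algebra.adjoin ℤ (heckeRing0Generators L 2) at hu
    induction hu using Algebra.adjoin_induction with
    | mem u hu =>
      obtain ⟨p, hp, rfl⟩ := hu
      intro t ht x y
      have htT : t = HeckeRing0.T L 2 p hp :=
        HeckeRing0.toEnd_injective L 2 (by rw [ht, HeckeRing0.toEnd_T])
      rw [htT]
      exact hgen p hp x y
    | algebraMap r =>
      intro t ht x y
      have htr : t = (r : HeckeRing0 L 2) :=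
        HeckeRing0.toEnd_injective L 2 (by rw [ht, map_intCast]; exact (eq_intCast (algebraMap ℤ _) r))
      rw [htr, Int.cast_smul_eq_zsmul (HeckeRing0 L 2) r x, Int.cast_smul_eq_zsmul (HeckeRing0 L 2) r y, map_zsmul,
        map_zsmul, AddMonoidHom.zsmul_apply]
    | add u v hu hv ihu ihv =>
      intro t ht x y
      let t₁ : HeckeRing0 L 2 := (HeckeRing0.toSubalgebra L 2).symm ⟨u, hu⟩
      let t₂ : HeckeRing0 L 2 := (HeckeRing0.toSubalgebra L 2).symm ⟨v, hv⟩
      have ht₁ : HeckeRing0.toEnd L 2 t₁ = u := rfl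
      have ht₂ : HeckeRing0.toEnd L 2 t₂ = v := rfl
      have htt : t = t₁ + t₂ := HeckeRing0.toEnd_injective L 2 (by rw [map_add, ht₁, ht₂, ht])
      rw [htt, add_smul, add_smul, map_add, map_add, AddMonoidHom.add_apply, ihu t₁ ht₁, ihv t₂ ht₂]
    | mul u v hu hv ihu ihv =>
      intro t ht x y
      let t₁ : HeckeRing0 L 2 := (HeckeRing0.toSubalgebra L 2).symm ⟨u, hu⟩
      let t₂ : HeckeRing0 L 2 := (HeckeRing0.toSubalgebra L 2).symm ⟨v, hv⟩
      have ht₁ : HeckeRing0.toEnd L 2 t₁ = u := rfl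
      have ht₂ : HeckeRing0.toEnd L 2 t₂ = v := rfl
      have htt : t = t₁ * t₂ := HeckeRing0.toEnd_injective L 2 (by rw [map_mul, ht₁, ht₂, ht])
      rw [htt, mul_smul, ihu t₁ ht₁, ihv t₂ ht₂, ← mul_smul, mul_comm]
  exact key (HeckeRing0.toEnd L 2 t) (HeckeRing0.toEnd_mem L 2 t) t rfl x y

/-- In `ℤ/2`, a biadditive pairing kills doubles on the left: `Q (z + z) y = 0`. [folklore] -/
theorem pairing_add_self_left {M : Type*} [AddCommGroup M] (Q : M →+ (M →+ ZMod 2)) (z y : M) : Q (z + z) y = 0 := by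
  rw [Q.map_add, AddMonoidHom.add_apply, CharTwo.add_self_eq_zero]

/-- In `ℤ/2`, a biadditive pairing kills doubles on the right: `Q x (z + z) = 0`. [folklore] -/
theorem pairing_add_self_right {M : Type*} [AddCommGroup M] (Q : M →+ (M →+ ZMod 2)) (x z : M) : Q x (z + z) = 0 := by
  rw [(Q x).map_add, CharTwo.add_self_eq_zero]

/-- **Descent of a balanced mod-`2` pairing along a surjection with kernel `2Λ` (abstract).** `R` a commutative ring, `δ : Λ → M`
an `R`-linear surjection whose kernel is `{z + z}`; a balanced biadditive `B₀ : Λ × Λ → ℤ/2` (it kills doubles automatically) with left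
kernel inside `{z + z}` descends to a balanced pairing on `M` with trivial left kernel. [folklore] -/
theorem exists_pairing_of_surjective_ker_two {R : Type*} [CommRing R] {Λ M : Type*} [AddCommGroup Λ] [Module R Λ]
    [AddCommGroup M] [Module R M]
    (B₀ : Λ →+ (Λ →+ ZMod 2)) (hbal₀ : ∀ (t : R) (x y : Λ), B₀ (t • x) y = B₀ x (t • y))
    (hleft₀ : ∀ x : Λ, (∀ y, B₀ x y = 0) → ∃ z : Λ, x = z + z)
    (δ : Λ →ₗ[R] M) (hker : ∀ x : Λ, δ x = 0 ↔ ∃ z : Λ, x = z + z) (hsurj : Function.Surjective δ) :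
    ∃ B : M →+ (M →+ ZMod 2), (∀ (t : R) x y, B (t • x) y = B x (t • y)) ∧ (∀ x, (∀ y, B x y = 0) → x = 0) := by
  classical
  have hB₀2r : ∀ x z, B₀ x (z + z) = 0 := fun x z ↦ pairing_add_self_right B₀ x z
  have hB₀2l : ∀ z y, B₀ (z + z) y = 0 := fun z y ↦ pairing_add_self_left B₀ z y
  -- a set-theoretic section `s` of `δ`, additive and `R`-linear modulo doubles
  choose s hs using hsurj
  have hs_add : ∀ m m', ∃ z : Λ, s (m + m') = s m + s m' + (z + z) := by
    intro m m'
    have h0 : δ (s (m + m') - (s m + s m')) = 0 := by rw [δ.map_sub, δ.map_add, hs, hs, hs, sub_self]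
    obtain ⟨z, hz⟩ := (hker _).mp h0
    exact ⟨z, by rw [← hz, add_sub_cancel]⟩
  have hs_smul : ∀ (t : R) m, ∃ z : Λ, s (t • m) = t • s m + (z + z) := by
    intro t m
    have h0 : δ (s (t • m) - t • s m) = 0 := by rw [δ.map_sub, δ.map_smul, hs, hs, sub_self]
    obtain ⟨z, hz⟩ := (hker _).mp h0
    exact ⟨z, by rw [← hz, add_sub_cancel]⟩
  have hs_any : ∀ y : Λ, ∃ z : Λ, y = s (δ y) + (z + z) := by
    intro y
    have h0 : δ (y - s (δ y)) = 0 := by rw [δ.map_sub, hs, sub_self]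
    obtain ⟨z, hz⟩ := (hker _).mp h0
    exact ⟨z, by rw [← hz, add_sub_cancel]⟩
  -- the descended pairing `B(m, m') = B₀(s m, s m')`
  have hrow_add : ∀ m m' m'', B₀ (s m) (s (m' + m'')) = B₀ (s m) (s m') + B₀ (s m) (s m'') := by
    intro m m' m''
    obtain ⟨z, hz⟩ := hs_add m' m''
    rw [hz, (B₀ (s m)).map_add, (B₀ (s m)).map_add, hB₀2r, add_zero]
  have hcol_add : ∀ m m' m'', B₀ (s (m + m')) (s m'') = B₀ (s m) (s m'') + B₀ (s m') (s m'') := by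
    intro m m' m''
    obtain ⟨z, hz⟩ := hs_add m m'
    rw [hz, B₀.map_add, B₀.map_add, AddMonoidHom.add_apply, AddMonoidHom.add_apply, hB₀2l, add_zero]
  let Brow : M → (M →+ ZMod 2) := fun m ↦ AddMonoidHom.mk' (fun m' ↦ B₀ (s m) (s m')) (hrow_add m)
  have hBrow : ∀ m m', Brow m m' = B₀ (s m) (s m') := fun m m' ↦ rfl
  let B : M →+ (M →+ ZMod 2) := AddMonoidHom.mk' Brow (fun m m' ↦ by
    ext m''
    rw [AddMonoidHom.add_apply, hBrow, hBrow, hBrow, hcol_add])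
  have hB : ∀ m m', B m m' = B₀ (s m) (s m') := fun m m' ↦ rfl
  refine ⟨B, fun t m m' ↦ ?_, fun m hm ↦ ?_⟩
  · -- balanced
    obtain ⟨z, hz⟩ := hs_smul t m
    obtain ⟨z', hz'⟩ := hs_smul t m'
    rw [hB, hB, hz, hz', B₀.map_add, AddMonoidHom.add_apply, hB₀2l, add_zero, (B₀ (s m)).map_add, hB₀2r, add_zero,
      hbal₀]
  · -- trivial left kernel
    have hx : ∀ y : Λ, B₀ (s m) y = 0 := by
      intro y
      obtain ⟨z, hz⟩ := hs_any y
      rw [hz, (B₀ (s m)).map_add, hB₀2r, add_zero, ← hB]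
      exact hm _
    obtain ⟨z, hz⟩ := hleft₀ (s m) hx
    rw [← hs m, hz]
    exact (hker _).mpr ⟨z, rfl⟩

/-- **Descent of a balanced mod-`2` pairing from `Λ` to `J₀(L)[2]`.** A `𝕋`-balanced biadditive `B₀ : Λ × Λ → ℤ/2`
(`Λ = periodHomologyHecke L`; it kills `2Λ = {z + z}` on both sides automatically) whose left kernel is contained in `2Λ` descends
along `x ↦ [x/2]` (`J0.exists_linearDivMap`: onto `J₀(L)[2]`, kernel `2Λ`) to a `𝕋`-balanced pairing on `J₀(L)[2]` with trivial left
kernel. [cite: DarmonDiamondTaylor1995, §1.3 (pp. 27–28) (`J[ℓ] = ℓ⁻¹Λ/Λ`) and §1.6 Lemma 1.38] -/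
theorem exists_pairing_torsionBy_two_of_pairing_periodHomology
    (B₀ : periodHomologyHecke L →+ (periodHomologyHecke L →+ ZMod 2))
    (hbal₀ : ∀ (t : HeckeRing0 L 2) (x y : periodHomologyHecke L), B₀ (t • x) y = B₀ x (t • y))
    (hleft₀ : ∀ x : periodHomologyHecke L, (∀ y, B₀ x y = 0) → ∃ z : periodHomologyHecke L, x = z + z) :
    ∃ B : Submodule.torsionBy (HeckeRing0 L 2) (J0 L) ((2 : ℕ) : HeckeRing0 L 2) →+
        (Submodule.torsionBy (HeckeRing0 L 2) (J0 L) ((2 : ℕ) : HeckeRing0 L 2) →+ ZMod 2),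
      (∀ (t : HeckeRing0 L 2) x y, B (t • x) y = B x (t • y)) ∧ (∀ x, (∀ y, B x y = 0) → x = 0) := by
  -- the descent map `δ : Λ → J₀(L)`, `x ↦ [x/2]`: kernel `2Λ`, image `J₀(L)[2]`; corestricted to `J₀(L)[2]`
  obtain ⟨δ, -, hker, hsurj⟩ := J0.exists_linearDivMap L (ℓ := 2) two_ne_zero
  have hker' : ∀ x : periodHomologyHecke L, δ x = 0 ↔ ∃ z : periodHomologyHecke L, x = z + z := by
    intro x
    rw [hker x]
    simp only [two_nsmul]
  have hδmem : ∀ x : periodHomologyHecke L, δ x ∈ Submodule.torsionBy (HeckeRing0 L 2) (J0 L) ((2 : ℕ) : HeckeRing0 L 2) := by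
    intro x
    rw [Submodule.mem_torsionBy_iff, Nat.cast_smul_eq_nsmul, two_nsmul, ← δ.map_add, (hker' _).mpr ⟨x, rfl⟩]
  let δ' : periodHomologyHecke L →ₗ[HeckeRing0 L 2] Submodule.torsionBy (HeckeRing0 L 2) (J0 L) ((2 : ℕ) : HeckeRing0 L 2) :=
    LinearMap.codRestrict _ δ hδmem
  have hδ' : ∀ x, (δ' x : J0 L) = δ x := fun x ↦ rfl
  have hker'' : ∀ x : periodHomologyHecke L, δ' x = 0 ↔ ∃ z : periodHomologyHecke L, x = z + z := by
    intro x
    rw [← hker' x, ← hδ' x]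
    exact ⟨fun h ↦ by rw [h, ZeroMemClass.coe_zero], fun h ↦ Subtype.ext h⟩
  have hsurj' : Function.Surjective δ' := by
    intro m
    obtain ⟨x, hx⟩ := hsurj _ m.2
    exact ⟨x, Subtype.ext hx⟩
  exact exists_pairing_of_surjective_ker_two B₀ hbal₀ hleft₀ δ' hker'' hsurj'

/-- **The `w`-twist of a mod-`2` pairing adjoint to `T_p` (`p ∤ L`) and with `U_qᵗ = w U_q w` (`q ∣ L`) is `𝕋`-balanced on the
generators.** With `Q`, `w` as in `sdTwo_of_twistedAdjointPairing`: `Q(T_p x, w y) = Q(x, w (T_p y))` for every prime `p`.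
[cite: DarmonDiamondTaylor1995, §1.6 Lemma 1.38 (p. 41)] [cite: Merel1995Homologie, §2.1–2.3] -/
theorem twist_balanced_T
    (Q : periodHomologyHecke L →+ (periodHomologyHecke L →+ ZMod 2))
    (w : periodHomologyHecke L →+ periodHomologyHecke L)
    (hww : ∀ y : periodHomologyHecke L, ∃ z : periodHomologyHecke L, w (w y) = y + (z + z))
    (hT : ∀ (p : ℕ) (hp : p.Prime), ¬ p ∣ L → ∀ x y : periodHomologyHecke L,
      Q (HeckeRing0.T L 2 p hp • x) y = Q x (HeckeRing0.T L 2 p hp • y))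
    (hTw : ∀ (p : ℕ) (hp : p.Prime), ¬ p ∣ L → ∀ y : periodHomologyHecke L, ∃ z : periodHomologyHecke L,
      w (HeckeRing0.T L 2 p hp • y) = HeckeRing0.T L 2 p hp • w y + (z + z))
    (hU : ∀ (q : ℕ) (hq : q.Prime), q ∣ L → ∀ x y : periodHomologyHecke L,
      Q (HeckeRing0.T L 2 q hq • x) y = Q x (w (HeckeRing0.T L 2 q hq • w y)))
    (p : ℕ) (hp : p.Prime) (x y : periodHomologyHecke L) :
    Q (HeckeRing0.T L 2 p hp • x) (w y) = Q x (w (HeckeRing0.T L 2 p hp • y)) := by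
  by_cases hpL : p ∣ L
  · -- `Q(U x, w y) = Q(x, w U w (w y)) = Q(x, w U (y + 2z)) = Q(x, w U y)`
    obtain ⟨z, hz⟩ := hww y
    have e1 : Q (HeckeRing0.T L 2 p hp • x) (w y) = Q x (w (HeckeRing0.T L 2 p hp • w (w y))) := hU p hp hpL x (w y)
    have e2 : w (HeckeRing0.T L 2 p hp • w (w y)) =
        w (HeckeRing0.T L 2 p hp • y) + (w (HeckeRing0.T L 2 p hp • z) + w (HeckeRing0.T L 2 p hp • z)) := by
      rw [hz, smul_add, smul_add, w.map_add, w.map_add]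
    have e3 : Q x (w (HeckeRing0.T L 2 p hp • w (w y))) = Q x (w (HeckeRing0.T L 2 p hp • y)) := by
      rw [e2, (Q x).map_add, pairing_add_self_right, add_zero]
    exact e1.trans e3
  · -- `Q(T x, w y) = Q(x, T w y) = Q(x, w T y - 2z) = Q(x, w T y)`
    obtain ⟨z, hz⟩ := hTw p hp hpL y
    have e1 : Q (HeckeRing0.T L 2 p hp • x) (w y) = Q x (HeckeRing0.T L 2 p hp • w y) := hT p hp hpL x (w y)
    have e2 : Q x (w (HeckeRing0.T L 2 p hp • y)) = Q x (HeckeRing0.T L 2 p hp • w y) := by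
      rw [hz, (Q x).map_add, pairing_add_self_right, add_zero]
    exact e1.trans e2.symm

/-- **SD₂ at level `L` from a twisted-adjoint mod-`2` pairing on `Λ = periodHomologyHecke L`.** Data: `Q : Λ × Λ → ℤ/2` biadditive
(so it kills `2Λ` on both sides automatically) with LEFT kernel inside `2Λ = {z + z}`; `w : Λ → Λ` additive, an involution modulo `2Λ`;
adjointness `Q(T_p x, y) = Q(x, T_p y)` and `w T_p ≡ T_p w (mod 2Λ)` for primes `p ∤ L`, and `Q(U_q x, y) = Q(x, w(U_q(w y)))` for primes
`q ∣ L` (`U_q = HeckeRing0.T L 2 q`). Conclusion: `J₀(L)[2]` carries a `𝕋`-balanced `ℤ/2`-pairing with trivial left kernel — the pair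
(hbal, hleft) consumed everywhere — namely the descent of `B(x, y) := Q(x, w y)` along `x ↦ [x/2]` (`J0.exists_linearDivMap`).
This is the `ℓ = 2`, sign-free content of Darmon–Diamond–Taylor Lemma 1.38 («each `T` is adjoint to `wTw`»), with the mod-`2`
intersection form, the Fricke map and the Merel adjointness supplied as hypotheses (bricks S2–S6 of Lines/birth-sd2-architecture.md).
[cite: DarmonDiamondTaylor1995, §1.6 Lemma 1.38 (p. 41) and §1.3 (pp. 27–28)] [cite: Merel1995Homologie, §2.1–2.3] -/
theorem sdTwo_of_twistedAdjointPairing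
    (Q : periodHomologyHecke L →+ (periodHomologyHecke L →+ ZMod 2))
    (hQleft : ∀ x : periodHomologyHecke L, (∀ y, Q x y = 0) → ∃ z : periodHomologyHecke L, x = z + z)
    (w : periodHomologyHecke L →+ periodHomologyHecke L)
    (hww : ∀ y : periodHomologyHecke L, ∃ z : periodHomologyHecke L, w (w y) = y + (z + z))
    (hT : ∀ (p : ℕ) (hp : p.Prime), ¬ p ∣ L → ∀ x y : periodHomologyHecke L,
      Q (HeckeRing0.T L 2 p hp • x) y = Q x (HeckeRing0.T L 2 p hp • y))
    (hTw : ∀ (p : ℕ) (hp : p.Prime), ¬ p ∣ L → ∀ y : periodHomologyHecke L, ∃ z : periodHomologyHecke L,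
      w (HeckeRing0.T L 2 p hp • y) = HeckeRing0.T L 2 p hp • w y + (z + z))
    (hU : ∀ (q : ℕ) (hq : q.Prime), q ∣ L → ∀ x y : periodHomologyHecke L,
      Q (HeckeRing0.T L 2 q hq • x) y = Q x (w (HeckeRing0.T L 2 q hq • w y))) :
    ∃ B : Submodule.torsionBy (HeckeRing0 L 2) (J0 L) ((2 : ℕ) : HeckeRing0 L 2) →+
        (Submodule.torsionBy (HeckeRing0 L 2) (J0 L) ((2 : ℕ) : HeckeRing0 L 2) →+ ZMod 2),
      (∀ (t : HeckeRing0 L 2) x y, B (t • x) y = B x (t • y)) ∧ (∀ x, (∀ y, B x y = 0) → x = 0) := by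
  -- the twisted pairing `B₀(x, y) = Q(x, w y)` on `Λ`
  let B₀ : periodHomologyHecke L →+ (periodHomologyHecke L →+ ZMod 2) :=
    AddMonoidHom.mk' (fun x ↦ (Q x).comp w) (fun x x' ↦ by rw [Q.map_add, AddMonoidHom.add_comp])
  have hB₀ : ∀ x y, B₀ x y = Q x (w y) := fun x y ↦ rfl
  -- balanced on the generators, hence on `𝕋`
  have hgen : ∀ (p : ℕ) (hp : p.Prime) (x y : periodHomologyHecke L),
      B₀ (HeckeRing0.T L 2 p hp • x) y = B₀ x (HeckeRing0.T L 2 p hp • y) := fun p hp x y ↦ by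
    rw [hB₀, hB₀]
    exact twist_balanced_T Q w hww hT hTw hU p hp x y
  have hbal₀ : ∀ (t : HeckeRing0 L 2) x y, B₀ (t • x) y = B₀ x (t • y) := balanced_of_balanced_T B₀ hgen
  -- the left kernel of `B₀` is inside `2Λ` (`w` is onto modulo `2Λ`)
  have hwwQ : ∀ x y : periodHomologyHecke L, Q x (w (w y)) = Q x y := by
    intro x y
    obtain ⟨z, hz⟩ := hww y
    have h := congrArg (Q x) hz
    rw [(Q x).map_add, pairing_add_self_right, add_zero] at h
    exact h
  have hleft₀ : ∀ x, (∀ y, B₀ x y = 0) → ∃ z : periodHomologyHecke L, x = z + z :=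
    fun x hx ↦ hQleft x fun y ↦ (hwwQ x y).symm.trans (hx (w y))
  exact exists_pairing_torsionBy_two_of_pairing_periodHomology B₀ hbal₀ hleft₀

end Assembly

end Summit.BirchSwinnertonDyer.BirchSwinnertonDyer.Theorems.ThetaLayerLambdaCongruenceAtTwo

end
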